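import Literature.NumberTheory.K2Lit.DoublingZetaIntegral
import Mathlib.MeasureTheory.Integral.Prod
import HarnessLib

/-!
# Continuity of the doubling pairing under uniform convergence of the kernel — organ (O45)(i) of socket #44∕45, abstract half

Track B ∕ hLiu418 = stmt-HodgeConjecture-24832, line `K2_Liu_CurveThetaSigs`, unit U6 (the s5 seam), socket #44∕45 `sig_K2LiuUndoublingSeparation`,
organ (O45) «separation of variables by pure tensors», part (i) «continuity of `Φ ↦ pairing`» (LEAD F0P6-plan GO 2026-09-03 23:34Z: statement
in the seat's words); seat `hodgecm-mathlib-K2Liu-p03` (g2). ABSTRACT HALF (pure Mathlib over ★ `K2Lit/DoublingZetaIntegral.doublingPairing`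
`= ∫ K x · φ₁ x.1 · conj (φ₂ x.2) d(μ ⊗ μ)`): if a family of kernels `F : S → [G]² → ℂ` on a topological space `S` is, at `s₀`, bounded and
a.e.-strongly measurable, and converges UNIFORMLY (`∀ ε > 0`, eventually `‖F s x − F s₀ x‖ ≤ ε` for all `x`, with `F s` a.e.-strongly measurable),
then for INTEGRABLE weights `w₁, w₂` the pairing `s ↦ doublingPairing μ (F s) w₁ w₂` is continuous at `s₀` — the estimate
`|⟨F s − F s₀, w₁ ⊗ w̄₂⟩| ≤ ε · ‖w₁‖₁ · ‖w₂‖₁` (no countability of `𝓝 s₀` needed, so `S` may be the Schwartz–Bruhat space). The THETA HALF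
(uniform convergence of `Φ ↦ θ^□_Φ(ι(x₁,x₂), q)` on the compact `[G]² × [U(⟨a′⟩)]` from ★ `ThetaKernelDatum.continuous_thetaKer`) is organ (O45)(i-b).

* `integrable_kernel_mul_weights` — a bounded a.e.-strongly measurable kernel times `w₁(x₁) · conj w₂(x₂)` is `μ ⊗ μ`-integrable.
* `norm_doublingPairing_sub_le` — `‖pairing(K) − pairing(K′)‖ ≤ ε · ∫ |w₁(x₁)| |w₂(x₂)|` when `‖K − K′‖ ≤ ε` pointwise.
* `continuousAt_doublingPairing_of_uniform` — the continuity statement.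

No definition, no instance, no named fact; axioms ⊆ {propext, Classical.choice, Quot.sound}.

## References
* M. Harris, S. Kudla, W. J. Sweet, *Theta dichotomy for unitary groups*, J. AMS 9 (1996), §1 proof of Lem. 1.1 [HarrisKudlaSweet1996].
* A. Weil, *Sur certains groupes d'opérateurs unitaires*, Acta Math. 111 (1964), §§18–20 [Weil1964].

HONEST LABEL: HC_CM is proved only modulo the 7 printed citations (2 remaining named inputs: hLiu418 =
stmt-HodgeConjecture-24832, h413 = stmt-HodgeConjecture-24833) until rung 0 closes; this helper moves no counter.
-/

noncomputable section

set_option autoImplicit false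

set_option linter.dupNamespace false

open scoped Matrix Topology
open NumberField IsDedekindDomain MeasureTheory Filter

namespace Summit.HodgeConjecture.HodgeConjecture.Cruxes.HLiu418.K2LiuDoublingPairingContinuous

open Literature.NumberTheory.Automorphic Literature.NumberTheory.GaloisRepresentations
open Literature.NumberTheory.GelbartRogawski1991 Literature.NumberTheory.GelbartRogawski1991.GRConstruction
open Literature.NumberTheory.K2Lit.SiegelDoubled

variable {K : Type} [Field K] [NumberField K] (𝒢 : AdelicGroupData.{0} K)
  (μ : Measure 𝒢.automorphicQuotient)

/-- **A bounded measurable kernel times integrable weights is integrable on `[G]²`**: if `‖Kx‖ ≤ C` and `Kf` is a.e.-strongly measurable for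
`μ ⊗ μ`, and `w₁, w₂ ∈ L¹(μ)`, then `x ↦ Kf x · w₁ x.1 · conj (w₂ x.2)` is `μ ⊗ μ`-integrable (domination by `C |w₁(x₁)| |w₂(x₂)|`,
Mathlib `Integrable.mul_prod`). [cite: HarrisKudlaSweet1996, §1 proof of Lem. 1.1] -/
theorem integrable_kernel_mul_weights {Kf : 𝒢.automorphicQuotient × 𝒢.automorphicQuotient → ℂ} {C : ℝ}
    (hKm : AEStronglyMeasurable Kf (μ.prod μ)) (hKb : ∀ x, ‖Kf x‖ ≤ C)
    {w₁ w₂ : 𝒢.automorphicQuotient → ℂ} (hw₁ : Integrable w₁ μ) (hw₂ : Integrable w₂ μ) :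
    Integrable (fun x : 𝒢.automorphicQuotient × 𝒢.automorphicQuotient => Kf x * w₁ x.1 * starRingEnd ℂ (w₂ x.2)) (μ.prod μ) := by
  have hw₁m : AEStronglyMeasurable (fun x : 𝒢.automorphicQuotient × 𝒢.automorphicQuotient => w₁ x.1) (μ.prod μ) :=
    hw₁.aestronglyMeasurable.comp_fst
  have hw₂m : AEStronglyMeasurable (fun x : 𝒢.automorphicQuotient × 𝒢.automorphicQuotient => starRingEnd ℂ (w₂ x.2)) (μ.prod μ) :=
    Complex.continuous_conj.comp_aestronglyMeasurable hw₂.aestronglyMeasurable.comp_snd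
  have hdom : Integrable (fun x : 𝒢.automorphicQuotient × 𝒢.automorphicQuotient => max C 0 * (‖w₁ x.1‖ * ‖w₂ x.2‖)) (μ.prod μ) :=
    (hw₁.norm.mul_prod hw₂.norm).const_mul (max C 0)
  refine hdom.mono' ((hKm.mul hw₁m).mul hw₂m) (Eventually.of_forall fun x => ?_)
  rw [norm_mul, norm_mul, Complex.norm_conj, mul_assoc]
  exact mul_le_mul_of_nonneg_right ((hKb x).trans (le_max_left _ _)) (mul_nonneg (norm_nonneg _) (norm_nonneg _))

/-- **The basic estimate**: if `‖Kf x − Kg x‖ ≤ ε` for all `x` (both kernels bounded and a.e.-strongly measurable) then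
`‖doublingPairing μ Kf w₁ w₂ − doublingPairing μ Kg w₁ w₂‖ ≤ ε · ∫ |w₁(x₁)| |w₂(x₂)| d(μ ⊗ μ)` for integrable `w₁, w₂`.
[cite: HarrisKudlaSweet1996, §1 proof of Lem. 1.1] -/
theorem norm_doublingPairing_sub_le {Kf Kg : 𝒢.automorphicQuotient × 𝒢.automorphicQuotient → ℂ} {Cf Cg ε : ℝ}
    (hfm : AEStronglyMeasurable Kf (μ.prod μ)) (hfb : ∀ x, ‖Kf x‖ ≤ Cf)
    (hgm : AEStronglyMeasurable Kg (μ.prod μ)) (hgb : ∀ x, ‖Kg x‖ ≤ Cg)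
    (hε : ∀ x, ‖Kf x - Kg x‖ ≤ ε)
    {w₁ w₂ : 𝒢.automorphicQuotient → ℂ} (hw₁ : Integrable w₁ μ) (hw₂ : Integrable w₂ μ) :
    ‖doublingPairing 𝒢 μ Kf w₁ w₂ - doublingPairing 𝒢 μ Kg w₁ w₂‖ ≤
      ε * ∫ x : 𝒢.automorphicQuotient × 𝒢.automorphicQuotient, ‖w₁ x.1‖ * ‖w₂ x.2‖ ∂(μ.prod μ) := by
  have hIf := integrable_kernel_mul_weights 𝒢 μ hfm hfb hw₁ hw₂
  have hIg := integrable_kernel_mul_weights 𝒢 μ hgm hgb hw₁ hw₂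
  unfold doublingPairing
  rw [← integral_sub hIf hIg, ← integral_const_mul]
  refine norm_integral_le_of_norm_le ((hw₁.norm.mul_prod hw₂.norm).const_mul ε) (Eventually.of_forall fun x => ?_)
  have hsub : Kf x * w₁ x.1 * starRingEnd ℂ (w₂ x.2) - Kg x * w₁ x.1 * starRingEnd ℂ (w₂ x.2) =
      (Kf x - Kg x) * w₁ x.1 * starRingEnd ℂ (w₂ x.2) := by ring
  rw [hsub, norm_mul, norm_mul, Complex.norm_conj, mul_assoc]
  exact mul_le_mul_of_nonneg_right (hε x) (mul_nonneg (norm_nonneg _) (norm_nonneg _))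

/-- **Continuity of the doubling pairing under uniform convergence of the kernel** (organ (O45)(i), abstract half). Let `S` be any
topological space, `F : S → [G]² → ℂ`, `s₀ ∈ S` with `F s₀` a.e.-strongly measurable and bounded, and suppose that for every `ε > 0`,
eventually in `𝓝 s₀` the kernel `F s` is a.e.-strongly measurable with `‖F s x − F s₀ x‖ ≤ ε` for all `x`. Then for integrable weights
`w₁, w₂` the map `s ↦ doublingPairing μ (F s) w₁ w₂` is continuous at `s₀` (no first-countability of `S` is used — in the application `S`
is the Schwartz–Bruhat space `𝒮(𝔸^{n″})` and `F Φ = (x ↦ ∫_q θ^□_Φ(ι(x₁, x₂), q) dν)`). [cite: HarrisKudlaSweet1996, §1 proof of Lem. 1.1]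
[cite: Weil1964, §§18–20] -/
theorem continuousAt_doublingPairing_of_uniform {S : Type*} [TopologicalSpace S]
    (F : S → 𝒢.automorphicQuotient × 𝒢.automorphicQuotient → ℂ) (s₀ : S) {C : ℝ}
    (hm₀ : AEStronglyMeasurable (F s₀) (μ.prod μ)) (hb₀ : ∀ x, ‖F s₀ x‖ ≤ C)
    (hunif : ∀ ε : ℝ, 0 < ε → ∀ᶠ s in 𝓝 s₀, AEStronglyMeasurable (F s) (μ.prod μ) ∧ ∀ x, ‖F s x - F s₀ x‖ ≤ ε)
    {w₁ w₂ : 𝒢.automorphicQuotient → ℂ} (hw₁ : Integrable w₁ μ) (hw₂ : Integrable w₂ μ) :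
    ContinuousAt (fun s => doublingPairing 𝒢 μ (F s) w₁ w₂) s₀ := by
  set I : ℝ := ∫ x : 𝒢.automorphicQuotient × 𝒢.automorphicQuotient, ‖w₁ x.1‖ * ‖w₂ x.2‖ ∂(μ.prod μ) with hI
  have hI0 : 0 ≤ I := integral_nonneg fun x => mul_nonneg (norm_nonneg _) (norm_nonneg _)
  rw [ContinuousAt, Metric.tendsto_nhds]
  intro ε hε
  -- choose δ with δ · I < ε
  set δ : ℝ := ε / (I + 1) with hδ
  have hδ0 : 0 < δ := div_pos hε (by linarith)
  have hδI : δ * I < ε := by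
    rw [hδ, div_mul_eq_mul_div, div_lt_iff₀ (by linarith : (0 : ℝ) < I + 1)]
    nlinarith
  filter_upwards [hunif δ hδ0] with s hs
  obtain ⟨hms, hds⟩ := hs
  have hbs : ∀ x, ‖F s x‖ ≤ C + δ := fun x => by
    calc ‖F s x‖ = ‖F s₀ x + (F s x - F s₀ x)‖ := by rw [add_sub_cancel]
      _ ≤ ‖F s₀ x‖ + ‖F s x - F s₀ x‖ := norm_add_le _ _
      _ ≤ C + δ := add_le_add (hb₀ x) (hds x)
  rw [dist_eq_norm]
  calc ‖doublingPairing 𝒢 μ (F s) w₁ w₂ - doublingPairing 𝒢 μ (F s₀) w₁ w₂‖ ≤ δ * I :=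
        norm_doublingPairing_sub_le 𝒢 μ hms hbs hm₀ hb₀ hds hw₁ hw₂
    _ < ε := hδI

end Summit.HodgeConjecture.HodgeConjecture.Cruxes.HLiu418.K2LiuDoublingPairingContinuous

end
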